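import Literature.Computability.AlgebraicComplexity.StrassenPreorderMaximal
import HarnessLib

/-!
# The monotone homomorphism of a total Strassen preorder (Zuiddam 2018, Lemma 2.9) — proved

Topic `Literature/Computability/AlgebraicComplexity`; fourth file of the abstract theory of asymptotic
spectra (see `StrassenPreorder.lean`). Everything here is proved.

## Content

* **Zuiddam Lemma 2.9** (existence part): for a *total* Strassen preorder `≼` on `S` the function
  `φ(a) = inf { r/s : r, s ∈ ℕ, s ≥ 1, s a ≼ r }` is a `≼`-monotone semiring homomorphism `S → ℝ≥0`
  (`IsStrassenPreorder.exists_isSpectralPoint_of_total`). The proof is Zuiddam's: by totality every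
  fraction `u/v < φ(a)` satisfies `u ≼ v a` (`le_of_div_lt`), so `φ` is also the supremum of the lower
  fractions, and additivity/multiplicativity follow by sandwiching. The helper lemmas are phrased for
  any `φ` with `IsGLB {r/s : s a ≼ r} (φ a)` so that no auxiliary definition is needed.
* `IsStrassenPreorder.exists_isSpectralPoint` — every Strassen preorder admits a spectral point
  (maximal extension, Lemma 2.7, Lemma 2.9); in particular the asymptotic spectrum is nonempty
  (Zuiddam Thm. 2.15(i)).

## References

* J. Zuiddam, PhD thesis (2018), §2.6, Lemma 2.9; Thm. 2.15(i). [Zuiddam2018]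
* V. Strassen, J. reine angew. Math. 384 (1988), §2. [Strassen1988]

## Mathlib

`isGLB_csInf`, `IsGLB.exists_between`, `Nat.ceil_lt_add_one`, `exists_nat_gt`,
`le_of_forall_pos_lt_add`.
-/

noncomputable section

namespace Literature.Computability.AlgebraicComplexity

universe u

variable {S : Type u} [CommSemiring S]

namespace IsSpectralPoint

/-- A spectral point of a larger preorder is a spectral point of a smaller one. [cite: Zuiddam2018, Def. 2.8] -/
theorem of_imp {le le' : S → S → Prop} {φ : S → ℝ} (hφ : IsSpectralPoint le' φ)
    (hle : ∀ x y, le x y → le' x y) : IsSpectralPoint le φ where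
  map_one := hφ.map_one
  map_add := hφ.map_add
  map_mul := hφ.map_mul
  mono hxy := hφ.mono (hle _ _ hxy)

end IsSpectralPoint

namespace IsStrassenPreorder

variable {le : S → S → Prop}

section GLB

/-! ### The function `φ(a) = inf {r/s : s a ≼ r}` of a total Strassen preorder -/

variable (h : IsStrassenPreorder le) {φ : S → ℝ}
  (hφ : ∀ a : S, IsGLB {q : ℝ | ∃ r s : ℕ, 0 < s ∧ le ((s : S) * a) (r : S) ∧ q = (r : ℝ) / (s : ℝ)}
    (φ a))
include h hφ

/-- Upper fractions bound `φ` from above: `s a ≼ r ⇒ φ(a) ≤ r/s`. [cite: Zuiddam2018, Lemma 2.9] -/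
theorem glb_le_div {a : S} {r s : ℕ} (hs : 0 < s) (hle : le ((s : S) * a) (r : S)) :
    φ a ≤ (r : ℝ) / (s : ℝ) := by
  have _ := h
  exact (hφ a).1 ⟨r, s, hs, hle, rfl⟩

/-- Lower fractions bound `φ` from below: `u ≼ v a ⇒ u/v ≤ φ(a)` ("`ψ(a) ≤ φ(a)`": `s u ≼ s v a ≼ v r`). [cite: Zuiddam2018, Lemma 2.9] -/
theorem div_le_glb {a : S} {u v : ℕ} (hv : 0 < v) (hle : le (u : S) ((v : S) * a)) :
    (u : ℝ) / (v : ℝ) ≤ φ a := by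
  refine (hφ a).2 ?_
  rintro _ ⟨r, s, hs, hsr, rfl⟩
  have h1 : le ((s : S) * (u : S)) ((s : S) * ((v : S) * a)) := h.mul_left _ hle
  have h2 : le ((v : S) * ((s : S) * a)) ((v : S) * (r : S)) := h.mul_left _ hsr
  have e : (s : S) * ((v : S) * a) = (v : S) * ((s : S) * a) := by ring
  rw [e] at h1
  have h3 := h.trans h1 h2
  rw [← Nat.cast_mul, ← Nat.cast_mul, h.natCast_le_iff] at h3
  rw [div_le_div_iff₀ (by exact_mod_cast hv) (by exact_mod_cast hs)]
  exact_mod_cast (by linarith [h3] : u * s ≤ r * v)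

/-- `0 ≤ φ(a)`. [cite: Zuiddam2018, Lemma 2.9] -/
theorem glb_nonneg (a : S) : 0 ≤ φ a := by
  have := h.div_le_glb hφ (a := a) (u := 0) (v := 1) Nat.one_pos (by simpa using h.zero_le a)
  simpa using this

/-- Upper fractions just above `φ(a)` exist. [cite: Zuiddam2018, Lemma 2.9] -/
theorem exists_div_lt_glb_add (a : S) {ε : ℝ} (hε : 0 < ε) :
    ∃ r s : ℕ, 0 < s ∧ le ((s : S) * a) (r : S) ∧ (r : ℝ) / (s : ℝ) < φ a + ε := by
  have _ := h
  obtain ⟨_, ⟨r, s, hs, hle, rfl⟩, -, hlt⟩ := (hφ a).exists_between (lt_add_of_pos_right (φ a) hε)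
  exact ⟨r, s, hs, hle, hlt⟩

variable (htot : ∀ a b : S, le a b ∨ le b a)
include htot

/-- **Totality**: every fraction strictly below `φ(a)` is a lower fraction, `u/v < φ(a) ⇒ u ≼ v a`
(else `v a ≼ u` and `φ(a) ≤ u/v`). [cite: Zuiddam2018, Lemma 2.9] -/
theorem le_of_div_lt_glb {a : S} {u v : ℕ} (hv : 0 < v) (hlt : (u : ℝ) / (v : ℝ) < φ a) :
    le (u : S) ((v : S) * a) := by
  rcases htot (u : S) ((v : S) * a) with h1 | h1
  · exact h1
  · exact absurd (h.glb_le_div hφ hv h1) (not_le.2 hlt)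

/-- Lower fractions just below `φ(a)` exist (for `φ(a) < δ` the fraction `0/1`). [cite: Zuiddam2018, Lemma 2.9] -/
theorem exists_glb_sub_lt_div (a : S) {δ : ℝ} (hδ : 0 < δ) :
    ∃ u v : ℕ, 0 < v ∧ le (u : S) ((v : S) * a) ∧ φ a - δ < (u : ℝ) / (v : ℝ) ∧
      (u : ℝ) / (v : ℝ) ≤ φ a := by
  by_cases hsmall : φ a < δ
  · refine ⟨0, 1, Nat.one_pos, by simpa using h.zero_le a, ?_, ?_⟩
    · simp; linarith
    · simpa using h.glb_nonneg hφ a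
  · rw [not_lt] at hsmall
    -- `v > 2/δ`, `u = ⌈v φ(a)⌉ - 1`
    obtain ⟨v, hv⟩ := exists_nat_gt (2 / δ)
    have hv0 : (0 : ℝ) < v := lt_trans (div_pos two_pos hδ) hv
    have hvpos : 0 < v := by exact_mod_cast hv0
    have hvδ : 2 < (v : ℝ) * δ := by rwa [div_lt_iff₀ hδ] at hv
    have hx0 : 0 ≤ (v : ℝ) * φ a := mul_nonneg hv0.le (h.glb_nonneg hφ a)
    have hx2 : 2 < (v : ℝ) * φ a := by nlinarith
    set c : ℕ := ⌈(v : ℝ) * φ a⌉₊ with hc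
    have hc1 : (v : ℝ) * φ a ≤ c := Nat.le_ceil _
    have hc2 : (c : ℝ) < (v : ℝ) * φ a + 1 := Nat.ceil_lt_add_one hx0
    have hcge : 1 ≤ c := by
      have : (1 : ℝ) ≤ c := by linarith
      exact_mod_cast this
    refine ⟨c - 1, v, hvpos, ?_, ?_, ?_⟩
    · refine h.le_of_div_lt_glb hφ htot hvpos ?_
      rw [div_lt_iff₀ hv0, Nat.cast_sub hcge, Nat.cast_one]
      linarith
    · rw [lt_div_iff₀ hv0, Nat.cast_sub hcge, Nat.cast_one]
      nlinarith
    · rw [div_le_iff₀ hv0, Nat.cast_sub hcge, Nat.cast_one]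
      linarith

/-- `φ(a + b) ≤ φ(a) + φ(b)`. [cite: Zuiddam2018, Lemma 2.9] -/
theorem glb_add_le (a b : S) : φ (a + b) ≤ φ a + φ b := by
  have _ := htot
  refine le_of_forall_pos_lt_add fun ε hε => ?_
  obtain ⟨ra, sa, hsa, hlea, hlta⟩ := h.exists_div_lt_glb_add hφ a (half_pos hε)
  obtain ⟨rb, sb, hsb, hleb, hltb⟩ := h.exists_div_lt_glb_add hφ b (half_pos hε)
  have h1 : le (((sa * sb : ℕ) : S) * (a + b)) ((sb * ra + sa * rb : ℕ) : S) := by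
    have := h.add_le_add (h.mul_left (sb : S) hlea) (h.mul_left (sa : S) hleb)
    have e1 : ((sa * sb : ℕ) : S) * (a + b) = (sb : S) * ((sa : S) * a) + (sa : S) * ((sb : S) * b) := by
      push_cast; ring
    have e2 : ((sb * ra + sa * rb : ℕ) : S) = (sb : S) * (ra : S) + (sa : S) * (rb : S) := by
      norm_cast
    rwa [e1, e2]
  have h2 := h.glb_le_div hφ (Nat.mul_pos hsa hsb) h1
  have hsa0 : (0 : ℝ) < sa := by exact_mod_cast hsa
  have hsb0 : (0 : ℝ) < sb := by exact_mod_cast hsb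
  have e : (((sb * ra + sa * rb : ℕ) : ℝ)) / ((sa * sb : ℕ) : ℝ) = ra / sa + rb / sb := by
    rw [div_add_div _ _ hsa0.ne' hsb0.ne']
    push_cast; ring
  rw [e] at h2
  linarith

/-- `φ(a) + φ(b) ≤ φ(a + b)`. [cite: Zuiddam2018, Lemma 2.9] -/
theorem add_glb_le (a b : S) : φ a + φ b ≤ φ (a + b) := by
  refine le_of_forall_pos_lt_add fun ε hε => ?_
  obtain ⟨ua, va, hva, hlea, hlta, -⟩ := h.exists_glb_sub_lt_div hφ htot a (half_pos hε)
  obtain ⟨ub, vb, hvb, hleb, hltb, -⟩ := h.exists_glb_sub_lt_div hφ htot b (half_pos hε)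
  have h1 : le ((vb * ua + va * ub : ℕ) : S) (((va * vb : ℕ) : S) * (a + b)) := by
    have := h.add_le_add (h.mul_left (vb : S) hlea) (h.mul_left (va : S) hleb)
    have e1 : ((vb * ua + va * ub : ℕ) : S) = (vb : S) * (ua : S) + (va : S) * (ub : S) := by
      norm_cast
    have e2 : ((va * vb : ℕ) : S) * (a + b) = (vb : S) * ((va : S) * a) + (va : S) * ((vb : S) * b) := by
      push_cast; ring
    rwa [e1, e2]
  have h2 := h.div_le_glb hφ (Nat.mul_pos hva hvb) h1
  have hva0 : (0 : ℝ) < va := by exact_mod_cast hva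
  have hvb0 : (0 : ℝ) < vb := by exact_mod_cast hvb
  have e : (((vb * ua + va * ub : ℕ) : ℝ)) / ((va * vb : ℕ) : ℝ) = ua / va + ub / vb := by
    rw [div_add_div _ _ hva0.ne' hvb0.ne']
    push_cast; ring
  rw [e] at h2
  linarith

/-- `φ(a b) ≤ φ(a) φ(b)`. [cite: Zuiddam2018, Lemma 2.9] -/
theorem glb_mul_le (a b : S) : φ (a * b) ≤ φ a * φ b := by
  have _ := htot
  have ha0 := h.glb_nonneg hφ a
  have hb0 := h.glb_nonneg hφ b
  refine le_of_forall_pos_lt_add fun η hη => ?_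
  -- choose `ε` with `ε (φ a + φ b + ε) ≤ η`
  set ε : ℝ := min 1 (η / (φ a + φ b + 1)) with hε
  have hε0 : 0 < ε := by rw [hε]; positivity
  have hε1 : ε ≤ 1 := min_le_left _ _
  have hεη : ε * (φ a + φ b + 1) ≤ η := by
    have : ε ≤ η / (φ a + φ b + 1) := min_le_right _ _
    rwa [le_div_iff₀ (by positivity)] at this
  obtain ⟨ra, sa, hsa, hlea, hlta⟩ := h.exists_div_lt_glb_add hφ a hε0
  obtain ⟨rb, sb, hsb, hleb, hltb⟩ := h.exists_div_lt_glb_add hφ b hε0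
  have h1 : le (((sa * sb : ℕ) : S) * (a * b)) ((ra * rb : ℕ) : S) := by
    have := h.mul_le_mul hlea hleb
    have e1 : ((sa * sb : ℕ) : S) * (a * b) = ((sa : S) * a) * ((sb : S) * b) := by push_cast; ring
    have e2 : ((ra * rb : ℕ) : S) = (ra : S) * (rb : S) := by norm_cast
    rwa [e1, e2]
  have h2 := h.glb_le_div hφ (Nat.mul_pos hsa hsb) h1
  have hsa0 : (0 : ℝ) < sa := by exact_mod_cast hsa
  have hsb0 : (0 : ℝ) < sb := by exact_mod_cast hsb
  have e : (((ra * rb : ℕ) : ℝ)) / ((sa * sb : ℕ) : ℝ) = (ra / sa) * (rb / sb) := by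
    push_cast; field_simp
  rw [e] at h2
  have hra0 : (0 : ℝ) ≤ ra / sa := by positivity
  have hrb0 : (0 : ℝ) ≤ rb / sb := by positivity
  have h3 : (ra / sa : ℝ) * (rb / sb) ≤ (φ a + ε) * (φ b + ε) :=
    _root_.mul_le_mul hlta.le hltb.le hrb0 (by linarith)
  nlinarith

/-- `φ(a) φ(b) ≤ φ(a b)`. [cite: Zuiddam2018, Lemma 2.9] -/
theorem mul_glb_le (a b : S) : φ a * φ b ≤ φ (a * b) := by
  have ha0 := h.glb_nonneg hφ a
  have hb0 := h.glb_nonneg hφ b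
  by_contra hlt
  rw [not_le] at hlt
  have hab0 := h.glb_nonneg hφ (a * b)
  have ha : 0 < φ a := by
    rcases ha0.eq_or_lt with h0 | h0
    · rw [← h0, zero_mul] at hlt; linarith
    · exact h0
  have hb : 0 < φ b := by
    rcases hb0.eq_or_lt with h0 | h0
    · rw [← h0, mul_zero] at hlt; linarith
    · exact h0
  set gap : ℝ := φ a * φ b - φ (a * b) with hgap
  have hgap0 : 0 < gap := by rw [hgap]; linarith
  set δ : ℝ := min (min (φ a / 2) (φ b / 2)) (gap / (φ a + φ b)) with hδ
  have hδ0 : 0 < δ := by rw [hδ]; positivity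
  have hδa : δ < φ a := lt_of_le_of_lt ((min_le_left _ _).trans (min_le_left _ _)) (by linarith)
  have hδb : δ < φ b := lt_of_le_of_lt ((min_le_left _ _).trans (min_le_right _ _)) (by linarith)
  have hδg : δ * (φ a + φ b) ≤ gap := by
    have : δ ≤ gap / (φ a + φ b) := min_le_right _ _
    rwa [le_div_iff₀ (by positivity)] at this
  obtain ⟨ua, va, hva, hlea, hlta, -⟩ := h.exists_glb_sub_lt_div hφ htot a hδ0
  obtain ⟨ub, vb, hvb, hleb, hltb, -⟩ := h.exists_glb_sub_lt_div hφ htot b hδ0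
  have h1 : le ((ua * ub : ℕ) : S) (((va * vb : ℕ) : S) * (a * b)) := by
    have := h.mul_le_mul hlea hleb
    have e1 : ((ua * ub : ℕ) : S) = (ua : S) * (ub : S) := by norm_cast
    have e2 : ((va * vb : ℕ) : S) * (a * b) = ((va : S) * a) * ((vb : S) * b) := by push_cast; ring
    rwa [e1, e2]
  have h2 := h.div_le_glb hφ (Nat.mul_pos hva hvb) h1
  have hva0 : (0 : ℝ) < va := by exact_mod_cast hva
  have hvb0 : (0 : ℝ) < vb := by exact_mod_cast hvb
  have e : (((ua * ub : ℕ) : ℝ)) / ((va * vb : ℕ) : ℝ) = (ua / va) * (ub / vb) := by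
    push_cast; field_simp
  rw [e] at h2
  have h3 : (φ a - δ) * (φ b - δ) < (ua / va : ℝ) * (ub / vb) :=
    mul_lt_mul'' hlta hltb (by linarith) (by linarith)
  nlinarith

/-- `φ` is monotone. [cite: Zuiddam2018, Lemma 2.9] -/
theorem glb_mono {a b : S} (hab : le a b) : φ a ≤ φ b := by
  have _ := htot
  refine (hφ b).2 ?_
  rintro _ ⟨r, s, hs, hsr, rfl⟩
  exact h.glb_le_div hφ hs (h.trans (h.mul_left _ hab) hsr)

/-- `φ(1) = 1`. [cite: Zuiddam2018, Lemma 2.9] -/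
theorem glb_one : φ 1 = 1 := by
  have _ := htot
  refine le_antisymm ?_ ?_
  · have := h.glb_le_div hφ (a := 1) (r := 1) (s := 1) Nat.one_pos (by simpa using h.refl 1)
    simpa using this
  · have := h.div_le_glb hφ (a := 1) (u := 1) (v := 1) Nat.one_pos (by simpa using h.refl 1)
    simpa using this

end GLB

/-- **Zuiddam Lemma 2.9** (existence): a total Strassen preorder has a spectral point, namely
`φ(a) = inf {r/s : s a ≼ r}`. [cite: Zuiddam2018, Lemma 2.9] -/
theorem exists_isSpectralPoint_of_total (h : IsStrassenPreorder le)
    (htot : ∀ a b : S, le a b ∨ le b a) : ∃ φ : S → ℝ, IsSpectralPoint le φ := by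
  set φ : S → ℝ := fun a =>
    sInf {q : ℝ | ∃ r s : ℕ, 0 < s ∧ le ((s : S) * a) (r : S) ∧ q = (r : ℝ) / (s : ℝ)} with hφdef
  have hφ : ∀ a : S, IsGLB {q : ℝ | ∃ r s : ℕ, 0 < s ∧ le ((s : S) * a) (r : S) ∧
      q = (r : ℝ) / (s : ℝ)} (φ a) := by
    intro a
    refine isGLB_csInf ?_ ⟨0, ?_⟩
    · obtain ⟨r, hr⟩ := h.exists_le_natCast a
      exact ⟨r / 1, r, 1, Nat.one_pos, by simpa using hr, by simp⟩
    · rintro _ ⟨r, s, -, -, rfl⟩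
      positivity
  refine ⟨φ, ?_⟩
  exact
    { map_one := h.glb_one hφ htot
      map_add := fun a b =>
        le_antisymm (h.glb_add_le hφ htot a b) (h.add_glb_le hφ htot a b)
      map_mul := fun a b =>
        le_antisymm (h.glb_mul_le hφ htot a b) (h.mul_glb_le hφ htot a b)
      mono := fun hab => h.glb_mono hφ htot hab }

/-- Every Strassen preorder has a spectral point (maximal extension — Lemma 2.7 — Lemma 2.9); the
asymptotic spectrum `X(S, ≼)` is nonempty (Zuiddam Thm. 2.15(i)). [cite: Zuiddam2018, Thm. 2.15] -/
theorem exists_isSpectralPoint (h : IsStrassenPreorder le) : ∃ φ : S → ℝ, IsSpectralPoint le φ := by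
  obtain ⟨le', h', hle', htot', -⟩ := h.exists_maximal_total
  obtain ⟨φ, hφ⟩ := h'.exists_isSpectralPoint_of_total htot'
  exact ⟨φ, hφ.of_imp hle'⟩

/-- A Strassen preorder extends to one with a spectral point: if `≼ ⊆ ≼'` are Strassen preorders then
some spectral point of `≼` is monotone for `≼'`. [cite: Zuiddam2018, Lemma 2.9] -/
theorem exists_isSpectralPoint_of_imp (h : IsStrassenPreorder le) {le' : S → S → Prop}
    (h' : IsStrassenPreorder le') (hle : ∀ x y, le x y → le' x y) :
    ∃ φ : S → ℝ, IsSpectralPoint le φ ∧ IsSpectralPoint le' φ := by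
  have _ := h
  obtain ⟨φ, hφ⟩ := h'.exists_isSpectralPoint
  exact ⟨φ, hφ.of_imp hle, hφ⟩

end IsStrassenPreorder

end Literature.Computability.AlgebraicComplexity

end
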